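import Mathlib
import HarnessLib.Audit
import Summits.PneNP.PneNP.Theorems.PstarChordReadHubLocal

/-!
# Hub calculus: locality of restricted readers along a common partner (ROUND-24, O1 beyond tightness; memo g22 §23)

FRONTIER range-avoidance ladder, rung F-N3, ROUND 24 (cell `pnp-ideate`, prover-2 memo `g22/O1-PAIRCORE-g22.md` §23; typed target
`PstarCoreBoundTargets.TerminalPeelable` (p646951); restricted-model proof complexity — nothing here bears on `P` versus `NP`).

A small calculus for the hub two-chord theorem (two chords `cᵢ, cⱼ` gated on one common outside variable `z`).  `SameData I cᵢ cⱼ x x'`: the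
assignments agree on the data of both chords (XOR sums and AND pairs).  `LocalAt I cᵢ cⱼ z κ C G`: the value of the reader `(C, G)` on the
hyperplane `{x_z = κ}` is a function of the two chords' data.  Then:

* `localAt_of_chordLocalᵢ` / `localAt_of_chordLocalⱼ` — a restricted reader `restrict1 C G z κ` chord-local at `cᵢ` or `cⱼ` is `LocalAt κ`;
  `localAt_of_const` — so is a reader constant on the hyperplane;
* `biChordLocal_of_localAt` — `LocalAt κ` plus a move of `z` that is a function of the two privates (`mv z x = F (x vᵢ) (x vⱼ)`, the hub shape)
  gives BI-CHORD-LOCALITY of the reader (`Γ = Γ|_κ ⊕ (x_z ⊕ κ)·mv z`);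
* `localAt_shift` — `LocalAt κ` implies `LocalAt κ'` for the same reader (same hub-shaped move of `z`);
* `localAt₂_of_localAt₁_sum` / `localAt₁_of_localAt₂_sum` — locality of one reader and of the SUM reader `(C₁ ∆ C₂, G₁ ∆ G₂)` gives locality of
  the other (`PstarGSystemFreeVar.gval_symmDiff`).

With `PstarChordReadHubLocal` (directions ⟹ chord-locality of restricted readers) and `PstarChordReadBiLocal.false_of_biLocal₂` this is the whole
engine of the hub theorem (sequel `PstarChordReadHubCore`).  No Assumption A.
-/

set_option linter.dupNamespace false -- `Summit.PneNP.PneNP.…`: summit = sub-problem name (D-0017 single-conjunct layout)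

open Finset Literature.Computability.Complexity
open scoped symmDiff
open Summit.PneNP.PneNP.Theorems.PstarSALevel (varSet SimpleOverlap)
open Summit.PneNP.PneNP.Theorems.PstarCentreFree (vars_mem_varSet)
open Summit.PneNP.PneNP.Theorems.PstarGapOneAll (gval)
open Summit.PneNP.PneNP.Theorems.PstarGSystemFreeVar (gval_symmDiff)
open Summit.PneNP.PneNP.Theorems.PstarChordReadLemma (ChordLocal)
open Summit.PneNP.PneNP.Theorems.PstarChordReadFlip (mv mv_update_self)
open Summit.PneNP.PneNP.Theorems.PstarChordReadRestrictVar (restrict1 gval_restrict1)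
open Summit.PneNP.PneNP.Theorems.PstarChordReadBiLocal (BiChordLocal)
open Summit.PneNP.PneNP.Theorems.PstarChordReadHubLocal (gval_eq_restrict_xor)

namespace Summit.PneNP.PneNP.Theorems.PstarChordReadHubCalc

variable {n m : ℕ}

/-- The assignments `x, x'` AGREE ON THE DATA OF THE CHORDS `cᵢ, cⱼ`: XOR sums and both AND variables of each. -/
def SameData (I : LocalMap 4 n m) (cᵢ cⱼ : Fin m) (x x' : Fin n → Bool) : Prop :=
  xor (x (I.vars cᵢ 0)) (x (I.vars cᵢ 1)) = xor (x' (I.vars cᵢ 0)) (x' (I.vars cᵢ 1)) ∧ x (I.vars cᵢ 2) = x' (I.vars cᵢ 2) ∧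
    x (I.vars cᵢ 3) = x' (I.vars cᵢ 3) ∧
  xor (x (I.vars cⱼ 0)) (x (I.vars cⱼ 1)) = xor (x' (I.vars cⱼ 0)) (x' (I.vars cⱼ 1)) ∧ x (I.vars cⱼ 2) = x' (I.vars cⱼ 2) ∧
    x (I.vars cⱼ 3) = x' (I.vars cⱼ 3)

/-- The reader `(C, G)` is **LOCAL ON THE HYPERPLANE `{x_z = κ}`**: its value there is a function of the two chords' data. -/
def LocalAt (I : LocalMap 4 n m) (cᵢ cⱼ : Fin m) (z : Fin n) (κ : Bool) (C : Finset (Fin n)) (G : Finset (Fin m)) : Prop :=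
  ∀ x x' : Fin n → Bool, SameData I cᵢ cⱼ x x' → gval I C G (Function.update x z κ) = gval I C G (Function.update x' z κ)

section Calc

variable {I : LocalMap 4 n m} {J₀ : Finset (Fin m)} {cᵢ cⱼ : Fin m} {vᵢ vᵢ' vⱼ vⱼ' z : Fin n}
  (hvᵢ : (I.vars cᵢ 2 = vᵢ ∧ I.vars cᵢ 3 = vᵢ') ∨ (I.vars cᵢ 2 = vᵢ' ∧ I.vars cᵢ 3 = vᵢ))
  (hvⱼ : (I.vars cⱼ 2 = vⱼ ∧ I.vars cⱼ 3 = vⱼ') ∨ (I.vars cⱼ 2 = vⱼ' ∧ I.vars cⱼ 3 = vⱼ))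
  (hzᵢ : z ∉ varSet I cᵢ) (hzⱼ : z ∉ varSet I cⱼ)

/-- Same data is symmetric. -/
theorem SameData.symm {x x' : Fin n → Bool} (h : SameData I cᵢ cⱼ x x') : SameData I cᵢ cⱼ x' x :=
  ⟨h.1.symm, h.2.1.symm, h.2.2.1.symm, h.2.2.2.1.symm, h.2.2.2.2.1.symm, h.2.2.2.2.2.symm⟩

include hvᵢ hvⱼ in
/-- Same data gives the same privates `vᵢ, vⱼ`. -/
theorem SameData.priv {x x' : Fin n → Bool} (h : SameData I cᵢ cⱼ x x') : x vᵢ = x' vᵢ ∧ x vⱼ = x' vⱼ := by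
  obtain ⟨-, h2ᵢ, h3ᵢ, -, h2ⱼ, h3ⱼ⟩ := h
  refine ⟨?_, ?_⟩
  · rcases hvᵢ with ⟨h2, -⟩ | ⟨-, h3⟩
    · rw [← h2]; exact h2ᵢ
    · rw [← h3]; exact h3ᵢ
  · rcases hvⱼ with ⟨h2, -⟩ | ⟨-, h3⟩
    · rw [← h2]; exact h2ⱼ
    · rw [← h3]; exact h3ⱼ

include hzᵢ hzⱼ in
/-- Updating the outside variable `z` does not change the chord data. -/
theorem sameData_update (x : Fin n → Bool) (κ : Bool) : SameData I cᵢ cⱼ (Function.update x z κ) x := by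
  have hᵢ : ∀ s, Function.update x z κ (I.vars cᵢ s) = x (I.vars cᵢ s) := fun s =>
    Function.update_of_ne (fun e : I.vars cᵢ s = z => hzᵢ (e ▸ vars_mem_varSet I cᵢ s)) ..
  have hⱼ : ∀ s, Function.update x z κ (I.vars cⱼ s) = x (I.vars cⱼ s) := fun s =>
    Function.update_of_ne (fun e : I.vars cⱼ s = z => hzⱼ (e ▸ vars_mem_varSet I cⱼ s)) ..
  refine ⟨by rw [hᵢ, hᵢ], hᵢ 2, hᵢ 3, by rw [hⱼ, hⱼ], hⱼ 2, hⱼ 3⟩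

include hzᵢ hzⱼ in
/-- Same data is preserved by updating `z` on both sides. -/
theorem SameData.update {x x' : Fin n → Bool} (h : SameData I cᵢ cⱼ x x') (κ : Bool) :
    SameData I cᵢ cⱼ (Function.update x z κ) (Function.update x' z κ) := by
  obtain ⟨a1, a2, a3, a4, a5, a6⟩ := sameData_update hzᵢ hzⱼ x κ
  obtain ⟨b1, b2, b3, b4, b5, b6⟩ := sameData_update hzᵢ hzⱼ x' κ
  obtain ⟨c1, c2, c3, c4, c5, c6⟩ := h
  exact ⟨by rw [a1, b1, c1], by rw [a2, b2, c2], by rw [a3, b3, c3], by rw [a4, b4, c4], by rw [a5, b5, c5], by rw [a6, b6, c6]⟩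

/-! ### Producing locality -/

/-- A reader constant on the hyperplane is local there. -/
theorem localAt_of_const {κ : Bool} {C : Finset (Fin n)} {G : Finset (Fin m)} {c₀ : Bool}
    (h : ∀ x : Fin n → Bool, x z = κ → gval I C G x = c₀) : LocalAt I cᵢ cⱼ z κ C G := fun x x' _ => by
  rw [h _ (Function.update_self ..), h _ (Function.update_self ..)]

/-- **A restricted reader chord-local at `cᵢ` is local on the hyperplane.** -/
theorem localAt_of_chordLocalᵢ (hI : I.IsPure xorAndPred) (hS : SimpleOverlap I) {κ : Bool} {C : Finset (Fin n)} {G : Finset (Fin m)}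
    (h : ChordLocal I cᵢ (restrict1 I C G z κ).1 (restrict1 I C G z κ).2) : LocalAt I cᵢ cⱼ z κ C G := by
  obtain ⟨φ, hφ⟩ := h
  intro x x' hd
  obtain ⟨d1, d2, d3, -, -, -⟩ := hd
  have e := hφ x
  have e' := hφ x'
  rw [gval_restrict1 I hI hS] at e e'
  rw [d1, d2, d3, ← e'] at e
  revert e
  cases gval I C G (Function.update x z κ) <;> cases gval I C G (Function.update x' z κ) <;> cases (κ && decide (z ∈ C)) <;> decide

/-- **A restricted reader chord-local at `cⱼ` is local on the hyperplane.** -/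
theorem localAt_of_chordLocalⱼ (hI : I.IsPure xorAndPred) (hS : SimpleOverlap I) {κ : Bool} {C : Finset (Fin n)} {G : Finset (Fin m)}
    (h : ChordLocal I cⱼ (restrict1 I C G z κ).1 (restrict1 I C G z κ).2) : LocalAt I cᵢ cⱼ z κ C G := by
  obtain ⟨φ, hφ⟩ := h
  intro x x' hd
  obtain ⟨-, -, -, d1, d2, d3⟩ := hd
  have e := hφ x
  have e' := hφ x'
  rw [gval_restrict1 I hI hS] at e e'
  rw [d1, d2, d3, ← e'] at e
  revert e
  cases gval I C G (Function.update x z κ) <;> cases gval I C G (Function.update x' z κ) <;> cases (κ && decide (z ∈ C)) <;> decide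

/-! ### Using locality -/

include hvᵢ hvⱼ in
/-- **Locality on one hyperplane plus a hub-shaped move of `z` gives bi-chord-locality.** -/
theorem biChordLocal_of_localAt (hI : I.IsPure xorAndPred) (hz : ∀ j ∈ J₀, z ∉ varSet I j) {κ : Bool} {C : Finset (Fin n)}
    {G : Finset (Fin m)} (hloc : LocalAt I cᵢ cⱼ z κ C G) (F : Bool → Bool → Bool) (hmv : ∀ x : Fin n → Bool, mv I C G z x = F (x vᵢ) (x vⱼ)) :
    BiChordLocal I J₀ cᵢ cⱼ C G := by
  intro x x' hsᵢ hpᵢ hqᵢ hsⱼ hpⱼ hqⱼ hout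
  have hd : SameData I cᵢ cⱼ x x' := ⟨hsᵢ, hpᵢ, hqᵢ, hsⱼ, hpⱼ, hqⱼ⟩
  obtain ⟨eᵢ, eⱼ⟩ := hd.priv hvᵢ hvⱼ
  rw [gval_eq_restrict_xor hI C G z κ x, gval_eq_restrict_xor hI C G z κ x', hloc x x' hd, hmv, hmv, eᵢ, eⱼ, hout z hz]

include hvᵢ hvⱼ hzᵢ hzⱼ in
/-- **Locality shifts along `z`**: local at `κ` implies local at `κ'` (hub-shaped move of `z`). -/
theorem localAt_shift (hI : I.IsPure xorAndPred) {κ κ' : Bool} {C : Finset (Fin n)} {G : Finset (Fin m)}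
    (hloc : LocalAt I cᵢ cⱼ z κ C G) (F : Bool → Bool → Bool) (hmv : ∀ x : Fin n → Bool, mv I C G z x = F (x vᵢ) (x vⱼ)) :
    LocalAt I cᵢ cⱼ z κ' C G := by
  intro x x' hd
  obtain ⟨eᵢ, eⱼ⟩ := hd.priv hvᵢ hvⱼ
  have h := hloc _ _ (hd.update hzᵢ hzⱼ κ')
  rw [Function.update_idem, Function.update_idem] at h
  rw [gval_eq_restrict_xor hI C G z κ (Function.update x z κ'), gval_eq_restrict_xor hI C G z κ (Function.update x' z κ'),
    Function.update_idem, Function.update_idem, h, Function.update_self, Function.update_self, mv_update_self I C G hI,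
    mv_update_self I C G hI, hmv, hmv, eᵢ, eⱼ]

/-- **Locality of `Γ₁` and of the sum gives locality of `Γ₂`** (on the same hyperplane). -/
theorem localAt₂_of_localAt₁_sum {κ : Bool} {C₁ C₂ : Finset (Fin n)} {G₁ G₂ : Finset (Fin m)} (h₁ : LocalAt I cᵢ cⱼ z κ C₁ G₁)
    (hs : LocalAt I cᵢ cⱼ z κ (C₁ ∆ C₂) (G₁ ∆ G₂)) : LocalAt I cᵢ cⱼ z κ C₂ G₂ := by
  classical
  intro x x' hd
  have e₁ := h₁ x x' hd
  have es := hs x x' hd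
  rw [gval_symmDiff, gval_symmDiff, e₁] at es
  revert es
  cases gval I C₁ G₁ (Function.update x' z κ) <;> cases gval I C₂ G₂ (Function.update x z κ) <;>
    cases gval I C₂ G₂ (Function.update x' z κ) <;> decide

/-- **Locality of `Γ₂` and of the sum gives locality of `Γ₁`.** -/
theorem localAt₁_of_localAt₂_sum {κ : Bool} {C₁ C₂ : Finset (Fin n)} {G₁ G₂ : Finset (Fin m)} (h₂ : LocalAt I cᵢ cⱼ z κ C₂ G₂)
    (hs : LocalAt I cᵢ cⱼ z κ (C₁ ∆ C₂) (G₁ ∆ G₂)) : LocalAt I cᵢ cⱼ z κ C₁ G₁ := by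
  classical
  intro x x' hd
  have e₂ := h₂ x x' hd
  have es := hs x x' hd
  rw [gval_symmDiff, gval_symmDiff, e₂] at es
  revert es
  cases gval I C₂ G₂ (Function.update x' z κ) <;> cases gval I C₁ G₁ (Function.update x z κ) <;>
    cases gval I C₁ G₁ (Function.update x' z κ) <;> decide

end Calc

end Summit.PneNP.PneNP.Theorems.PstarChordReadHubCalc
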